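import Literature.NumberTheory.Automorphic.PrincipalSeriesGL2SatakeParameters
import Literature.NumberTheory.Automorphic.ParabolicGLReindex
import Literature.NumberTheory.Automorphic.ParabolicIndGLDetCharIrreducible
import HarnessLib

/-!
# Satake parameters of the unramified principal series of `GL₂`, in the `Q_{(1,1)}`-labelling
# `lastBlockLabel 2` (the currency of the split-place oscillator model)

Topic `Literature/NumberTheory/Automorphic`; proof file (theorems only: no definition, no named fact, no
instance).  The tree states the normalised principal series of `GL₂(F)` in two block labellings of the
same upper Borel subgroup: `parabolicIndGL F (id : Fin 2 → Fin 2) σ` (Levi `Π_{a : Fin 2} GL₁`; the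
currency of `PrincipalSeriesGL2JacquetModule`, `PrincipalSeriesGL2SatakeParameters`) and
`parabolicIndGL F (Zelevinsky1980.lastBlockLabel 2) ω` (Levi `Π_{a : Bool} GL₁`, `Q_{(N-1,1)}` at
`N = 2`; the currency of `Zelevinsky1980.maxParabolicLeviChar` and of the split-place model
`Liu2021.splitPlace_chiCoinv_iso_parabolicIndGL`).  This file bridges them:

* `parabolicIndGL_lastBlockLabel_two_equiv` — for any representation `ω` of the `Bool`-labelled Levi,
  an isomorphism of `GL₂(F)`-representations
  `parabolicIndGL F id (ω ∘ Θ) ≃ parabolicIndGL F (lastBlockLabel 2) ω`, `Θ = leviReindexHom` the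
  relabelling of Levi factors along `reindexGL (Equiv.refl _)` (the tree's `ParabolicGLReindex`
  transport `SmoothInd.transportEquiv`, Bernstein–Zelevinsky 1977, §2.3: `i_{G,M}` only depends on
  the partition);
* `isSatakeParameter_parabolicIndGL_lastBlockLabel_two` — **for unramified characters `ν, χ : Fˣ → ℂˣ`
  the Satake parameter of `Ind_{Q_{(1,1)}}^{GL₂}((ν ∘ det) ⊠ χ)` (normalised induction of
  `maxParabolicLeviChar F 2 ν χ`) is `{ν(ϖ), χ(ϖ)}`** — the head of
  `PrincipalSeriesGL2SatakeParameters` (`isSatakeParameter_parabolicIndGL_fin_two`, Cartier §IV (4.2) /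
  Bump Prop. 4.6.6) transported along the bridge (Satake parameters are isomorphism invariants);
* `isSatakeParameter_of_equiv_parabolicIndGL_lastBlockLabel_two` — the same for ANY representation `Θ`
  of `GL₂(F)` isomorphic to `Ind_{Q_{(1,1)}}((ν∘det) ⊠ χ′ν^{1-2})` (the isomorphism as a hypothesis; the
  shape of the split-place oscillator model): Satake parameter `{ν(ϖ), χ′(ϖ)ν(ϖ)⁻¹}`.

This is the form consumed at a split place by the d6 line of cell hodgecm-mathlib (the local theta
quotient `ω(μ, ε, χ)_v ≅ Ind(ν ⊠ χ′ν⁻¹)`, [Liu2021, Lem. D.1]); nothing of [Liu2021] is used here.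

## References

* I. N. Bernstein, A. V. Zelevinsky, Ann. Sci. ÉNS 10 (1977), §2.3. [BernsteinZelevinsky1977]
* P. Cartier, *Representations of 𝔭-adic groups: a survey*, PSPM 33 (1979), part 1, §IV (4.2).
  [CartierCorvallis1979]
* D. Bump, *Automorphic forms and representations* (1997), Prop. 4.6.6. [Bump1997]
* A. V. Zelevinsky, Ann. Sci. ÉNS 13 (1980), §1.1, §3.2. [Zelevinsky1980]
-/

noncomputable section

open scoped MatrixGroups
open ValuativeRel

namespace Literature.NumberTheory.Automorphic

open Zelevinsky1980 (lastBlockLabel maxParabolicLeviChar)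

section LastBlock

variable {F : Type*} [Field F] [ValuativeRel F] [TopologicalSpace F] [IsNonarchimedeanLocalField F]

/-- The two labellings `id : Fin 2 → Fin 2` and `lastBlockLabel 2 : Fin 2 → Bool` induce the same
strict order on indices. [folklore] -/
private theorem id_lt_iff_lastBlockLabel_two_lt :
    ∀ i j : Fin 2, (id : Fin 2 → Fin 2) i < id j ↔
      lastBlockLabel 2 ((Equiv.refl (Fin 2)) i) < lastBlockLabel 2 ((Equiv.refl (Fin 2)) j) := by
  decide

omit [ValuativeRel F] [TopologicalSpace F] [IsNonarchimedeanLocalField F] in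
/-- `reindexGL (Equiv.refl _)` is the identity. [folklore] -/
private theorem reindexGL_refl_apply {m : Type*} [Fintype m] [DecidableEq m] (g : GL m F) :
    reindexGL (k := F) (Equiv.refl m) g = g := by
  refine Units.ext ?_
  rw [coe_reindexGL]
  ext i j
  rfl

/-- **Satake parameters pass along an isomorphism of representations** (one direction; the
`K₀`-fixed common eigenvector `v` goes to `e v`: `Representation.Equiv.fixedPoints_eq_map`, and `e`
commutes with each `T_i` because both sides are the same finite sum of translates,
`heckeOperator_apply_eq_sum` over one transversal).  Stated with the finiteness of the orbits
`K₀ t_i K₀ / K₀` as a hypothesis (true for `GL_n` over a local field; supplied below for `n = 2` from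
the explicit transversal).  Compare `isSatakeParameter_iff_of_equiv` of `RankinSelbergLocalEquiv`
(not imported: no hub build). [folklore] -/
private theorem isSatakeParameter_of_equiv' {n : ℕ} {V₁ V₂ : Type*} [AddCommGroup V₁] [Module ℂ V₁]
    [AddCommGroup V₂] [Module ℂ V₂] {π₁ : Representation ℂ (GL (Fin n) F) V₁}
    {π₂ : Representation ℂ (GL (Fin n) F) V₂} (e : π₁.Equiv π₂) {ϖ : Fˣ} {α : Multiset ℂ}
    (hfin : ∀ i ≤ n, (MulAction.orbit (glInt n F)
      ((heckeDiag n ϖ i : GL (Fin n) F) : GL (Fin n) F ⧸ glInt n F)).Finite)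
    (h : IsSatakeParameter π₁ ϖ α) : IsSatakeParameter π₂ ϖ α := by
  classical
  obtain ⟨hcard, v, hv, hv0, hT⟩ := h
  have hev : e v ∈ π₂.fixedPoints (glInt n F) := by
    rw [Representation.Equiv.fixedPoints_eq_map e]
    exact Submodule.mem_map_of_mem hv
  refine ⟨hcard, e v, hev, fun h0 => hv0 ?_, fun i hi => ?_⟩
  · have h := congrArg e.symm h0
    rwa [Representation.Equiv.symm_apply_apply, map_zero] at h
  -- one transversal `s` of the finite orbit serves both representations
  obtain ⟨s, hs⟩ : ∃ s : Finset (GL (Fin n) F), Set.BijOn (fun x : GL (Fin n) F => (x : GL (Fin n) F ⧸ glInt n F))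
      s (MulAction.orbit (glInt n F) ((heckeDiag n ϖ i : GL (Fin n) F) : GL (Fin n) F ⧸ glInt n F)) := by
    refine ⟨(hfin i hi).toFinset.image Quotient.out, ?_⟩
    refine ⟨fun x hx => ?_, fun x hx y hy hxy => ?_, fun γ hγ => ?_⟩
    · obtain ⟨γ, hγ, rfl⟩ := Finset.mem_image.1 (Finset.mem_coe.1 hx)
      change ((γ.out : GL (Fin n) F) : GL (Fin n) F ⧸ glInt n F) ∈ _
      rw [QuotientGroup.out_eq']
      exact (Set.Finite.mem_toFinset _).1 hγ
    · obtain ⟨γ, -, rfl⟩ := Finset.mem_image.1 (Finset.mem_coe.1 hx)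
      obtain ⟨γ', -, rfl⟩ := Finset.mem_image.1 (Finset.mem_coe.1 hy)
      change ((γ.out : GL (Fin n) F) : GL (Fin n) F ⧸ glInt n F) = ((γ'.out : GL (Fin n) F) : _ ⧸ glInt n F) at hxy
      rw [QuotientGroup.out_eq', QuotientGroup.out_eq'] at hxy
      rw [hxy]
    · refine ⟨γ.out, Finset.mem_coe.2 (Finset.mem_image.2 ⟨γ, (Set.Finite.mem_toFinset _).2 hγ, rfl⟩), ?_⟩
      exact QuotientGroup.out_eq' γ
  rw [heckeT_def, heckeOperator_apply_eq_sum _ _ _ s hs hev]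
  have h1 := hT i hi
  rw [heckeT_def, heckeOperator_apply_eq_sum _ _ _ s hs hv] at h1
  have h2 := congrArg e h1
  rw [map_sum, map_smul] at h2
  rw [← h2]
  refine Finset.sum_congr rfl fun x _ => ?_
  have hx := e.toIntertwiningMap.isIntertwining π₁ π₂ x v
  rw [Representation.Equiv.coe_toIntertwiningMap] at hx
  exact hx.symm

variable {W : Type*} [AddCommGroup W] [Module ℂ W]
  (ω : Representation ℂ (Π a : Bool, GL {i : Fin 2 // lastBlockLabel 2 i = a} F) W)

/-- **The two labellings of the Borel of `GL₂` give isomorphic principal series**: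
`parabolicIndGL F id (ω ∘ Θ) ≃ parabolicIndGL F (lastBlockLabel 2) ω` as representations of `GL₂(F)`,
where `Θ = leviReindexHom F (lastBlockLabel 2) (Equiv.refl _) id _` relabels the Levi factors
(`f ↦ f ∘ (reindexGL (Equiv.refl _))⁻¹ = f`; `SmoothInd.transportEquiv` of `ParabolicGLReindex`,
`δ^{1/2}` and the inducing data matching by `rootDeltaChar_transport` /
`leviProjection_parabolicReindex`). [cite: BernsteinZelevinsky1977, §2.3] -/
theorem parabolicIndGL_lastBlockLabel_two_equiv :
    Nonempty ((Representation.parabolicIndGL F (id : Fin 2 → Fin 2)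
        (ω.comp (leviReindexHom F (lastBlockLabel 2) (Equiv.refl (Fin 2)) (id : Fin 2 → Fin 2)
          id_lt_iff_lastBlockLabel_two_lt))).Equiv
      (Representation.parabolicIndGL F (lastBlockLabel 2) ω)) := by
  haveI : IsTopologicalRing F := inferInstance
  have hφ : Continuous (reindexGL (k := F) (Equiv.refl (Fin 2))) :=
    Units.continuous_map (f := (Matrix.reindexAlgEquiv F F (Equiv.refl (Fin 2))).toMulEquiv.toMonoidHom)
      (continuous_id.matrix_reindex _ _)
  have hφ' : Continuous (reindexGL (k := F) (Equiv.refl (Fin 2))).symm :=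
    Units.continuous_map (f := (Matrix.reindexAlgEquiv F F (Equiv.refl (Fin 2)).symm).toMulEquiv.toMonoidHom)
      (continuous_id.matrix_reindex _ _)
  have hH : ∀ x, reindexGL (k := F) (Equiv.refl (Fin 2)) x ∈ standardParabolicGL F (lastBlockLabel 2) ↔
      x ∈ standardParabolicGL F (id : Fin 2 → Fin 2) :=
    reindexGL_mem_standardParabolicGL_iff F id_lt_iff_lastBlockLabel_two_lt
  have hσ : ∀ x : standardParabolicGL F (id : Fin 2 → Fin 2),
      Representation.twist (((ω.comp (leviReindexHom F (lastBlockLabel 2) (Equiv.refl (Fin 2))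
          (id : Fin 2 → Fin 2) id_lt_iff_lastBlockLabel_two_lt)).comp
          (leviProjection F (id : Fin 2 → Fin 2))))
          (rootDeltaChar (standardParabolicGL F (id : Fin 2 → Fin 2))) x =
        Representation.twist (ω.comp (leviProjection F (lastBlockLabel 2)))
          (rootDeltaChar (standardParabolicGL F (lastBlockLabel 2)))
          ⟨reindexGL (k := F) (Equiv.refl (Fin 2)) x, (hH x).2 x.2⟩ := by
    intro x
    refine LinearMap.ext fun v => ?_
    change ((rootDeltaChar (standardParabolicGL F (id : Fin 2 → Fin 2)) x : ℂˣ) : ℂ) •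
        ω (leviReindexHom F (lastBlockLabel 2) (Equiv.refl (Fin 2)) (id : Fin 2 → Fin 2)
          id_lt_iff_lastBlockLabel_two_lt (leviProjection F (id : Fin 2 → Fin 2) x)) v =
      ((rootDeltaChar (standardParabolicGL F (lastBlockLabel 2))
          ⟨reindexGL (k := F) (Equiv.refl (Fin 2)) x, (hH x).2 x.2⟩ : ℂˣ) : ℂ) •
        ω (leviProjection F (lastBlockLabel 2) ⟨reindexGL (k := F) (Equiv.refl (Fin 2)) x, (hH x).2 x.2⟩) v
    rw [Representation.rootDeltaChar_transport (reindexGL (k := F) (Equiv.refl (Fin 2))) hφ hφ' hH x,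
      ← leviProjection_parabolicReindex F (lastBlockLabel 2) (Equiv.refl (Fin 2)) (id : Fin 2 → Fin 2)
        id_lt_iff_lastBlockLabel_two_lt x]
    rfl
  let Ψ := Representation.SmoothInd.transportEquiv (reindexGL (k := F) (Equiv.refl (Fin 2))) hφ hφ' hH hσ
  refine ⟨Representation.Equiv.mk Ψ fun g => LinearMap.ext fun f => ?_⟩
  change Ψ (Representation.parabolicIndGL F (id : Fin 2 → Fin 2) _ g f) =
    Representation.parabolicIndGL F (lastBlockLabel 2) ω g (Ψ f)
  have h := Representation.SmoothInd.transportEquiv_smoothIndRep (reindexGL (k := F) (Equiv.refl (Fin 2)))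
    hφ hφ' hH hσ g f
  rw [reindexGL_refl_apply] at h
  exact h

/-- **The Satake parameters of `Ind_{Q_{(1,1)}}^{GL₂}((ν∘det) ⊠ χ)` for unramified `ν, χ`** (the
labelling `lastBlockLabel 2`, Levi character `maxParabolicLeviChar F 2 ν χ` twisting the trivial
representation on `ℂ`): `{ν(ϖ), χ(ϖ)}` is a Satake parameter of
`parabolicIndGL F (lastBlockLabel 2) ((trivial).twist (maxParabolicLeviChar F 2 ν χ))` — the head of
`PrincipalSeriesGL2SatakeParameters` transported along `parabolicIndGL_lastBlockLabel_two_equiv`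
(Satake parameters pass along isomorphisms). Cartier §IV (4.2); Bump Prop. 4.6.6 («α₁ = χ₁(ϖ), α₂ = χ₂(ϖ)»).
[cite: CartierCorvallis1979, §IV (4.2)] [cite: Bump1997, Prop. 4.6.6] -/
theorem isSatakeParameter_parabolicIndGL_lastBlockLabel_two (ν χ : Fˣ →* ℂˣ)
    (hν : ∀ u : Fˣ, valuation F (u : F) = 1 → ν u = 1)
    (hχ : ∀ u : Fˣ, valuation F (u : F) = 1 → χ u = 1)
    {ϖ : F} (hϖ : IsUniformizingElement ϖ) :
    IsSatakeParameter (Representation.parabolicIndGL F (lastBlockLabel 2)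
        ((Representation.trivial ℂ (Π a : Bool, GL {i : Fin 2 // lastBlockLabel 2 i = a} F) ℂ).twist
          (maxParabolicLeviChar F 2 ν χ)))
      (Units.mk0 ϖ hϖ.ne_zero) {((ν (Units.mk0 ϖ hϖ.ne_zero) : ℂˣ) : ℂ), ((χ (Units.mk0 ϖ hϖ.ne_zero) : ℂˣ) : ℂ)} := by
  set ω := (Representation.trivial ℂ (Π a : Bool, GL {i : Fin 2 // lastBlockLabel 2 i = a} F) ℂ).twist
    (maxParabolicLeviChar F 2 ν χ) with hω
  obtain ⟨e⟩ := parabolicIndGL_lastBlockLabel_two_equiv ω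
  have hfin : ∀ i ≤ 2, (MulAction.orbit (glInt 2 F)
      ((heckeDiag 2 (Units.mk0 ϖ hϖ.ne_zero) i : GL (Fin 2) F) : GL (Fin 2) F ⧸ glInt 2 F)).Finite := by
    intro i hi
    rw [← (bijOn_heckeTransversal (n := 2) hϖ hi).image_eq]
    exact (Finset.finite_toSet _).image _
  refine isSatakeParameter_of_equiv' e hfin ?_
  -- the relabelled inducing datum acts through `(ν, χ)` on the diagonal
  have h0 : lastBlockLabel 2 (0 : Fin 2) = false := by decide
  have h1 : lastBlockLabel 2 (1 : Fin 2) = true := by decide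
  refine isSatakeParameter_parabolicIndGL_fin_two _ ν χ (fun u v w => ?_) hν hχ hϖ
  -- `σ(proj_id d(u,v)) = ω(proj_Q (reindex d(u,v))) = ν(u) χ(v)`
  have hdet : ∀ (a : Bool) (i : Fin 2) (ha : lastBlockLabel 2 i = a),
      Matrix.GeneralLinearGroup.det (leviProjection F (lastBlockLabel 2)
        (parabolicReindex F (lastBlockLabel 2) (Equiv.refl (Fin 2)) (id : Fin 2 → Fin 2)
          id_lt_iff_lastBlockLabel_two_lt ⟨diagGL2 u v, diagGL2_mem_standardParabolicGL_fin_two u v⟩) a) =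
        if i = 0 then u else v := by
    intro a i ha
    subst ha
    haveI : Subsingleton {j : Fin 2 // lastBlockLabel 2 j = lastBlockLabel 2 i} :=
      ⟨fun ⟨j, hj⟩ ⟨j', hj'⟩ => Subtype.ext (by revert hj hj'; revert i j j'; decide)⟩
    refine Units.ext ?_
    rw [Matrix.GeneralLinearGroup.val_det_apply, Matrix.det_eq_elem_of_subsingleton _ ⟨i, rfl⟩,
      leviProjection_apply_coe, coe_parabolicReindex, reindexGL_refl_apply, coe_diagGL2]
    fin_cases i <;> simp
  rw [MonoidHom.comp_apply, ← leviProjection_parabolicReindex, hω, Representation.twist_apply,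
    Representation.trivial_apply, Zelevinsky1980.maxParabolicLeviChar_apply, hdet false 0 h0, hdet true 1 h1]
  simp

/-- **Split-place form (the isomorphism as a hypothesis).**  Let `Θ` be ANY representation of
`GL₂(F)` isomorphic to the normalised induction `Ind_{Q_{(1,1)}}^{GL₂}((ν∘det) ⊠ χ′ν^{1-2})`
(`parabolicIndGL F (lastBlockLabel 2) ((trivial).twist (maxParabolicLeviChar F 2 ν (χ′ν^{1-2})))` —
the exact output currency of the tree's split-place model `Liu2021.splitPlace_chiCoinv_iso_parabolicIndGL`,
[Liu2021, Lem. D.1] / [MVW87, III.7]) with `ν, χ′` unramified.  Then `{ν(ϖ), χ′(ϖ)ν(ϖ)⁻¹}` is a Satake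
parameter of `Θ`.  (For a consumer holding `AreIsomorphicRep Θ I`, i.e. `∃ f, ∀ g v, f (Θ g v) = I g (f v)`:
`e := Representation.Equiv.mk f (fun g => LinearMap.ext (hf g))`.)
[cite: CartierCorvallis1979, §IV (4.2)] [cite: Bump1997, Prop. 4.6.6] -/
theorem isSatakeParameter_of_equiv_parabolicIndGL_lastBlockLabel_two {V : Type*} [AddCommGroup V]
    [Module ℂ V] {Θ : Representation ℂ (GL (Fin 2) F) V} (ν χ' : Fˣ →* ℂˣ)
    (hν : ∀ u : Fˣ, valuation F (u : F) = 1 → ν u = 1)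
    (hχ' : ∀ u : Fˣ, valuation F (u : F) = 1 → χ' u = 1)
    {ϖ : F} (hϖ : IsUniformizingElement ϖ)
    (e : Θ.Equiv (Representation.parabolicIndGL F (lastBlockLabel 2)
      ((Representation.trivial ℂ (Π a : Bool, GL {i : Fin 2 // lastBlockLabel 2 i = a} F) ℂ).twist
        (maxParabolicLeviChar F 2 ν (χ' * ν ^ (1 - ((2 : ℕ) : ℤ))))))) :
    IsSatakeParameter Θ (Units.mk0 ϖ hϖ.ne_zero)
      {((ν (Units.mk0 ϖ hϖ.ne_zero) : ℂˣ) : ℂ),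
        ((χ' (Units.mk0 ϖ hϖ.ne_zero) : ℂˣ) : ℂ) * (((ν (Units.mk0 ϖ hϖ.ne_zero) : ℂˣ) : ℂ))⁻¹} := by
  have hfin : ∀ i ≤ 2, (MulAction.orbit (glInt 2 F)
      ((heckeDiag 2 (Units.mk0 ϖ hϖ.ne_zero) i : GL (Fin 2) F) : GL (Fin 2) F ⧸ glInt 2 F)).Finite := by
    intro i hi
    rw [← (bijOn_heckeTransversal (n := 2) hϖ hi).image_eq]
    exact (Finset.finite_toSet _).image _
  have hz : ν ^ (1 - ((2 : ℕ) : ℤ)) = ν⁻¹ := by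
    rw [show (1 - ((2 : ℕ) : ℤ)) = -1 by norm_num]
    exact zpow_neg_one ν
  have hχ'' : ∀ u : Fˣ, valuation F (u : F) = 1 → (χ' * ν ^ (1 - ((2 : ℕ) : ℤ))) u = 1 := fun u hu => by
    rw [hz, MonoidHom.mul_apply, MonoidHom.inv_apply, hχ' u hu, hν u hu, inv_one, mul_one]
  have h := isSatakeParameter_of_equiv' e.symm hfin
    (isSatakeParameter_parabolicIndGL_lastBlockLabel_two ν (χ' * ν ^ (1 - ((2 : ℕ) : ℤ))) hν hχ'' hϖ)
  have hval : (((χ' * ν ^ (1 - ((2 : ℕ) : ℤ))) (Units.mk0 ϖ hϖ.ne_zero) : ℂˣ) : ℂ) =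
      ((χ' (Units.mk0 ϖ hϖ.ne_zero) : ℂˣ) : ℂ) * (((ν (Units.mk0 ϖ hϖ.ne_zero) : ℂˣ) : ℂ))⁻¹ := by
    rw [hz, MonoidHom.mul_apply, MonoidHom.inv_apply, Units.val_mul, Units.val_inv_eq_inv_val]
  rwa [hval] at h

end LastBlock

end Literature.NumberTheory.Automorphic

end
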